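import Mathlib
import Literature.NumberTheory.LFunctions.Zhang2022.SkeletonPartThree
import Literature.NumberTheory.LFunctions.Zhang2022.TypedAppendixB
import Literature.NumberTheory.LFunctions.Zhang2022.SkeletonAlpha1
import Literature.NumberTheory.LFunctions.Zhang2022.AppendixBLemma151Residues
import Literature.NumberTheory.LFunctions.Zhang2022.AppendixBLemma151Cauchy
import Literature.NumberTheory.LFunctions.Zhang2022.AppendixBLemma151Circles
import Literature.NumberTheory.LFunctions.Zhang2022.AppendixBLemma151Mu3Circles

/-!
# Zhang (2022) Appendix B, proof of Lemma 15.1, `μ = 1` ("The same argument also gives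
# `Σ_l ϰ₁(l₁l)ϱ_j(l)/l = e′_{1j} + O(α₁)`"): the three circle integrals of
# `ζ(1+s)/ζ(1+s−β_j)·(P₁/l₁)ˢ/((log P₁)(s−β₆)²)`, the two-circle split, the residue at `0` and its
# value, and the `μ = 1` residue-sum assembly towards `Typed.AppendixB.StepB_u012R`

Topic `Literature/NumberTheory/LFunctions/Zhang2022` (Landau–Siegel audit tree; verdict-neutral).
Y. Zhang, *Discrete mean estimates and the Landau–Siegel zero*, arXiv:2211.02515v1 (2022)
[Zhang2022LandauSiegel] — **an unrefereed manuscript under adjudication; nothing in this file asserts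
any claim of the manuscript beyond the displayed evaluations it PROVES.** ZHANG-L discharge lane (WP15,
App. B part B4 under leaf `Typed.Section15C.Eq15_22` / Lemma 15.1 χR(E); seat zl-w09-p5), DAG node
`Z22:§B.u012` [Z22 p.107, tex L5311]: "The same argument also gives
`Σ_l ϰ₁(l₁l)ϱ_j(l)/l = (1 − 2j/3 + j/(1.134πi))exp{0.756πi} − j/(1.134πi) + O(α₁)`" — the target
`Typed.AppendixB.StepB_u012R` (`Σ_l ϰ₁(l₁l)ϱ_j(l)/l = e′_{1j} + O(α₁)`, `α₁ = α log T`), i.e. the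
hypothesis `h12` of `Skeleton.hmu1E_of_u012R_tail` (`AppendixBLemma151MuOneE`, the RT-05 E-chain).

This file is the `(P₁, β₆)` TWIN of `AppendixBLemma151Mu3Circles` (zl-closer-4, the `(P₃, β₆)` chain)
and of `AppendixBLemma151Circles` / `AppendixBLemma151Residues` (the `μ = 2` chain of record), written
against the same generic tools (`kerB`, `zetaRatio`, `AppendixBLemma151Cauchy`, `beta6_size`):

* objects (INLINE, no definitions): `intB1(s) := zetaRatio c′ D j s · kerB (P₁ D) (β₆ D) l₁ s`
  (the `μ = 1` integrand `ζ(1+s)/ζ(1+s−β_j)·(P₁/l₁)ˢ/((log P₁)(s−β₆)²)`; `kerB`'s docstring: "for `ϰ₁`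
  with `P₁, β₆`"), `resZero1 := −β_j/(β₆² log P₁)` (the printed shape of the residue at `0`);
* `log_P1_mu1` (`log P₁ = 0.504·𝓛⁹` EXACTLY, (2.21));
* `intB_eq_G_div`, `circleIntegral_intB_eq_G`, `circleIntegrals_intB_beta6` — GENERIC in the Perron base
  `P_μ` (any `P_μ(D) > 1`; the `(P₃, β₆)` file's three lemmas are the `P₃` instances): with
  `G(s) = ζ₁(1+s)(s−β_j)ζ₁(1+s−β_j)⁻¹(P_μ/l₁)ˢ/log P_μ` (holomorphic on
  `|s| < 6α`), `(2πi)⁻¹∮_{|s|=5α} = G(0)/β₆² − G(β₆)/β₆² + G′(β₆)/β₆`,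
  `(2πi)⁻¹∮_{|s|=α} = G(0)/β₆²`, `(2πi)⁻¹∮_{|s−β₆|=α} = −G(β₆)/β₆² + G′(β₆)/β₆` (used here at `P₁`);
* `intB1_circle_split` (`∮_{|s|=5α} = ∮_{|s|=α} + ∮_{|s−β₆|=α}`), `circleIntegral_intB1_zero_eq`
  (`(2πi)⁻¹∮_{|s|=α} intB1 = resZero1·ζ₁(1−β_j)⁻¹`), `circleIntegral_intB1_zero_sub_resZero1_le`
  (`‖… − resZero1‖ ≤ C·α`), `resZero1_sub_main_le` (`‖resZero1 − (−j/(1.134πi))‖ ≤ C·α𝓛 ≤ C·α₁`,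
  `1.134 = (3/2)²·0.504`);
* the ASSEMBLY `stepB_mu1_rate_of` / `stepB_u012R_of`: from the `μ = 1` Perron identity
  (`Σ_l ϰ₁(l₁l)ϱ_j(l)/l = vline 1 (intB1)`), the `μ = 1` line-to-circle bound at rate `α₁` and the VALUE of
  the `β₆`-circle (`(1 − 2j/3 + j/(1.134πi))e^{0.756πi} + O(α₁)`) — all three as explicit hypotheses —
  to `Typed.AppendixB.StepB_u012R c′` (`e′_{1j}` = `Section18Defs.e1pj` = the sum of the two main values).

WHAT THIS IS NOT: the `μ = 1` Perron identity, the contour shift (line → circle), the value of the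
`β₆`-residue, (B.3), Lemma 15.1, or any claim about Theorems 1–2 / Landau–Siegel zeros.

## References

* Y. Zhang, arXiv:2211.02515v1 (2022), App. B p. 107 (proof of Lemma 15.1, `μ = 1, 2, 3`); §2 (2.10),
  (2.13), (2.21), (2.22); Lemma 15.1 p. 80 (`e′_{1j}`). [cite: Zhang2022LandauSiegel, App. B p.107]
-/

noncomputable section

open Complex Real Metric Set Filter Topology

namespace Literature.NumberTheory.LFunctions.Zhang2022.Skeleton

open Typed.AppendixB (zetaRatio kerB vline vkSum)

/-! ## The `μ = 1` objects (written INLINE; no new definitions)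

Throughout, the `μ = 1` integrand of App. B p. 107 ("The same argument also gives …") is the generic
`zetaRatio · kerB` of `TypedAppendixB` at `(P₁, β₆)`:
`intB1(s) := zetaRatio c′ D j s * kerB (P1 D) (beta6 D) l₁ s = ζ(1+s)/ζ(1+s−β_j)·(P₁/l₁)ˢ/((log P₁)(s−β₆)²)`,
and the printed shape of its residue at `0` is `resZero1 := −β_j/(β₆²·log P₁)`; both are spelled out in
every statement (this file declares no objects). -/

section Circles

variable (c' : ℝ)

/-- `L₀ ≤ log D` once `D ≥ ⌈exp L₀⌉₊`. [folklore] -/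
private theorem le_ell_of_ceil_exp_le₁ {L₀ : ℝ} {D : ℕ} (hD : ⌈Real.exp L₀⌉₊ ≤ D) : L₀ ≤ ell D := by
  have h : Real.exp L₀ ≤ D := le_trans (Nat.le_ceil _) (by exact_mod_cast hD)
  exact (Real.le_log_iff_exp_le (lt_of_lt_of_le (Real.exp_pos _) h)).mpr h

/-- `log P₁ = 0.504·𝓛⁹` ((2.21) `P₁ = P^{0.504}`, `P = e^{𝓛⁹}`). [cite: Zhang2022LandauSiegel, §2 (2.21)] -/
theorem log_P1_mu1 (D : ℕ) : Real.log (P1 D) = 0.504 * ell D ^ 9 := by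
  rw [P1, bigP, Real.log_rpow (Real.exp_pos _), Real.log_exp]

/-- `P₁ > 1` for `D ≥ 8` (`log P₁ = 0.504𝓛⁹ > 0` once `𝓛 > 0`). [cite: Zhang2022LandauSiegel, §2 (2.21)] -/
theorem one_lt_P1_mu1 (D : ℕ) (hD : 8 ≤ D) : 1 < P1 D := by
  have hD' : (1 : ℝ) < D := by exact_mod_cast (show 1 < D by omega)
  have hℓ0 : 0 < ell D := Real.log_pos hD'
  have h : 0 < Real.log (P1 D) := by rw [log_P1_mu1]; positivity
  have hP : 0 < P1 D := by rw [P1]; exact Real.rpow_pos_of_pos (Real.exp_pos _) _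
  by_contra hle
  push Not at hle
  have := Real.log_nonpos hP.le hle
  linarith

/-- **Generic in the Perron data `(P_μ, β)`.** For `s ≠ 0`, `s ≠ β_j` (with `ζ₁(1+s−β_j) ≠ 0`,
`log P_μ ≠ 0`): `ζ(1+s)/ζ(1+s−β_j)·(P_μ/l₁)ˢ/((log P_μ)(s−β)²) = G(s)/(s(s−β)²)` with
`G(s) = ζ₁(1+s)(s−β_j)ζ₁(1+s−β_j)⁻¹(P_μ/l₁)ˢ/log P_μ` (`ζ(1+s) = s⁻¹ζ₁(1+s)`, Mathlib
`riemannZeta_eq_inv_sub_mul`); the `(P₂,β₇)`/`(P₃,β₆)` instances are `intB2_eq_G_div`/`intB3_eq_G_div`.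
[cite: Zhang2022LandauSiegel, App. B p.107] -/
theorem intB_eq_G_div (D j l₁ : ℕ) (Pμ : ℝ) (β : ℂ) {s : ℂ} (hs0 : s ≠ 0) (hsb : s ≠ betaJ c' D j)
    (hz : riemannZeta₁ (1 + s - betaJ c' D j) ≠ 0) (hL : (Real.log Pμ : ℂ) ≠ 0) :
    zetaRatio c' D j s * kerB Pμ β l₁ s =
      (riemannZeta₁ (1 + s) * (s - betaJ c' D j) * (riemannZeta₁ (1 + s - betaJ c' D j))⁻¹ *
        ((Pμ / l₁ : ℝ) : ℂ) ^ s / (Real.log Pμ : ℂ)) / (s * (s - β) ^ 2) := by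
  have h1 : (1 : ℂ) + s ≠ 1 := fun h => hs0 (by linear_combination h)
  have h2 : (1 : ℂ) + s - betaJ c' D j ≠ 1 := fun h => hsb (by linear_combination h)
  rw [zetaRatio, kerB, riemannZeta_eq_inv_sub_mul h1, riemannZeta_eq_inv_sub_mul h2]
  have e1 : (1 : ℂ) + s - 1 = s := by ring
  have e2 : (1 : ℂ) + s - betaJ c' D j - 1 = s - betaJ c' D j := by ring
  rw [e1, e2]
  have hsb' : s - betaJ c' D j ≠ 0 := sub_ne_zero.mpr hsb
  field_simp

/-- **Generic in `(P_μ, β)`.** The circle integrals of `ζ(1+s)/ζ(1+s−β_j)·(P_μ/l₁)ˢ/((log P_μ)(s−β)²)`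
do not see the removable point `s = β_j`: over any circle not passing through `0` on which
`ζ₁(1+s−β_j) ≠ 0`, `∮ zetaRatio·kerB = ∮ G(s)/(s(s−β)²)` (a.e. congruence; the parametrisation hits
`β_j` only countably often). [cite: Zhang2022LandauSiegel, App. B p.107] -/
theorem circleIntegral_intB_eq_G (D j l₁ : ℕ) (Pμ : ℝ) (β : ℂ) {c : ℂ} {R : ℝ} (hR : R ≠ 0)
    (h0 : ∀ θ : ℝ, circleMap c R θ ≠ 0)
    (hz : ∀ θ : ℝ, riemannZeta₁ (1 + circleMap c R θ - betaJ c' D j) ≠ 0)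
    (hL : (Real.log Pμ : ℂ) ≠ 0) :
    (∮ s in C(c, R), zetaRatio c' D j s * kerB Pμ β l₁ s) = ∮ s in C(c, R),
      (riemannZeta₁ (1 + s) * (s - betaJ c' D j) * (riemannZeta₁ (1 + s - betaJ c' D j))⁻¹ *
        ((Pμ / l₁ : ℝ) : ℂ) ^ s / (Real.log Pμ : ℂ)) / (s * (s - β) ^ 2) := by
  have hcount : (circleMap c R ⁻¹' {betaJ c' D j}).Countable :=
    (Set.countable_singleton _).preimage_circleMap c hR
  refine intervalIntegral.integral_congr_ae ((hcount.ae_notMem _).mono fun θ hθ _ => ?_)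
  have hθ' : circleMap c R θ ≠ betaJ c' D j := hθ
  simp only [intB_eq_G_div c' D j l₁ Pμ β (h0 θ) hθ' (hz θ) hL]

/-- **The three circles at the pole `β₆`, GENERIC in the Perron base `P_μ = P_μ(D) > 1`** (covers
`μ = 1`: `P₁`, and `μ = 3`: `P₃`, of App. B p. 107), for `D` large (threshold from `zeta1_near_one` and
`c′`), every `j ∈ {1,2,3}` and `l₁ ≥ 1`: with `G(s) = ζ₁(1+s)(s−β_j)ζ₁(1+s−β_j)⁻¹(P_μ/l₁)ˢ/log P_μ`,
`(2πi)⁻¹∮_{|s|=5α} = G(0)/β₆² − G(β₆)/β₆² + G′(β₆)/β₆`, `(2πi)⁻¹∮_{|s|=α} = G(0)/β₆²`,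
`(2πi)⁻¹∮_{|s−β₆|=α} = −G(β₆)/β₆² + G′(β₆)/β₆` for the integrand `zetaRatio·kerB P_μ β₆`.
[cite: Zhang2022LandauSiegel, App. B p.107] -/
theorem circleIntegrals_intB_beta6 (Pμ : ℕ → ℝ) (hP : ∀ D : ℕ, 8 ≤ D → 1 < Pμ D) :
    ∃ D₀ : ℕ, ∀ D : ℕ, D₀ ≤ D → ∀ j ∈ ({1, 2, 3} : Finset ℕ),
    ∀ l₁ : ℕ, 1 ≤ l₁ →
      let G : ℂ → ℂ := fun s =>
        riemannZeta₁ (1 + s) * (s - betaJ c' D j) * (riemannZeta₁ (1 + s - betaJ c' D j))⁻¹ *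
          ((Pμ D / l₁ : ℝ) : ℂ) ^ s / (Real.log (Pμ D) : ℂ)
      (2 * π * I)⁻¹ * (∮ s in C((0 : ℂ), 5 * alpha D), zetaRatio c' D j s * kerB (Pμ D) (beta6 D) l₁ s) =
          G 0 / beta6 D ^ 2 - G (beta6 D) / beta6 D ^ 2 + deriv G (beta6 D) / beta6 D ∧
      (2 * π * I)⁻¹ * (∮ s in C((0 : ℂ), alpha D), zetaRatio c' D j s * kerB (Pμ D) (beta6 D) l₁ s) = G 0 / beta6 D ^ 2 ∧
      (2 * π * I)⁻¹ * (∮ s in C(beta6 D, alpha D), zetaRatio c' D j s * kerB (Pμ D) (beta6 D) l₁ s) =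
          -(G (beta6 D) / beta6 D ^ 2) + deriv G (beta6 D) / beta6 D := by
  obtain ⟨δ, hδ, K, hK, hζ⟩ := zeta1_near_one
  refine ⟨max 8 ⌈Real.exp (max (max 2 (60 * |c'| * π)) (max (10 * π / δ) (8 * K * π)))⌉₊,
    fun D hD j hj l₁ hl₁ => ?_⟩
  have hD8 : 8 ≤ D := le_trans (le_max_left _ _) hD
  obtain ⟨hℓ2, hc, hδα, hKα, hα0, hαπ, -⟩ :=
    large_package c' hδ hK (le_ell_of_ceil_exp_le₁ (le_trans (le_max_right _ _) hD))
  obtain ⟨-, hb4, hb2, -, -⟩ := betaJ_size c' hℓ2 hc hj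
  obtain ⟨hb6, hn6⟩ := beta6_size c' hℓ2 hc hj
  have hℓ0 : 0 < ell D := by linarith
  set b := betaJ c' D j with hbdef
  set a := alpha D with hadef
  have hL0 : 0 < Real.log (Pμ D) := Real.log_pos (hP D hD8)
  have hL : (Real.log (Pμ D) : ℂ) ≠ 0 := by exact_mod_cast hL0.ne'
  have hx : 0 < Pμ D / l₁ := by
    have : 0 < Pμ D := lt_trans zero_lt_one (hP D hD8)
    have hl : (0 : ℝ) < l₁ := by exact_mod_cast hl₁
    positivity
  -- `ζ₁(1 + s − β_j) ≠ 0` for `‖s‖ < 6α`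
  have hzU : ∀ s ∈ ball (0 : ℂ) (6 * a), riemannZeta₁ (1 + s - b) ≠ 0 := by
    intro s hs
    have hs' : ‖s‖ < 6 * a := by simpa using hs
    have : ‖s - b‖ ≤ δ := by
      calc ‖s - b‖ ≤ ‖s‖ + ‖b‖ := norm_sub_le _ _
        _ ≤ 6 * a + 4 * a := by linarith
        _ ≤ δ := by linarith
    have := (hζ (s - b) this).2.2
    rwa [show (1 : ℂ) + (s - b) = 1 + s - b by ring] at this
  -- `G` is holomorphic on `|s| < 6α` (`ζ₁` entire, `ζ₁(1+s−β_j) ≠ 0` there, `P₁/l₁ > 0`)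
  have hGd : DifferentiableOn ℂ (fun s : ℂ =>
      riemannZeta₁ (1 + s) * (s - b) * (riemannZeta₁ (1 + s - b))⁻¹ *
        ((Pμ D / l₁ : ℝ) : ℂ) ^ s / (Real.log (Pμ D) : ℂ)) (ball (0 : ℂ) (6 * a)) := by
    have hx' : ((Pμ D / l₁ : ℝ) : ℂ) ≠ 0 := by exact_mod_cast hx.ne'
    have h1 : Differentiable ℂ fun s : ℂ => riemannZeta₁ (1 + s) :=
      differentiable_riemannZeta₁.comp (differentiable_id.const_add 1)
    have h2 : Differentiable ℂ fun s : ℂ => riemannZeta₁ (1 + s - b) :=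
      differentiable_riemannZeta₁.comp ((differentiable_id.const_add 1).sub_const _)
    have h3 : Differentiable ℂ fun s : ℂ => ((Pμ D / l₁ : ℝ) : ℂ) ^ s :=
      fun s => differentiableAt_id.const_cpow (Or.inl hx')
    refine DifferentiableOn.div_const ?_ _
    refine ((h1.differentiableOn.mul (differentiableOn_id.sub_const _)).mul ?_).mul h3.differentiableOn
    exact h2.differentiableOn.inv hzU
  set G : ℂ → ℂ := fun s =>
    riemannZeta₁ (1 + s) * (s - b) * (riemannZeta₁ (1 + s - b))⁻¹ *
      ((Pμ D / l₁ : ℝ) : ℂ) ^ s / (Real.log (Pμ D) : ℂ) with hGdef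
  have hU : IsOpen (ball (0 : ℂ) (6 * a)) := isOpen_ball
  -- geometry of the three circles
  have h6ne : beta6 D ≠ 0 := by
    intro h; rw [h, norm_zero] at hn6; linarith
  have hbig0 : (0 : ℂ) ∈ ball (0 : ℂ) (5 * a) := mem_ball_self (by positivity)
  have hbig6 : beta6 D ∈ ball (0 : ℂ) (5 * a) := by
    rw [mem_ball_zero_iff, hn6]; linarith
  have hcl5 : closedBall (0 : ℂ) (5 * a) ⊆ ball (0 : ℂ) (6 * a) := closedBall_subset_ball (by linarith)
  have hcl1 : closedBall (0 : ℂ) a ⊆ ball (0 : ℂ) (6 * a) := closedBall_subset_ball (by linarith)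
  have hcl6 : closedBall (beta6 D) a ⊆ ball (0 : ℂ) (6 * a) := by
    intro s hs
    rw [mem_closedBall, dist_eq_norm] at hs
    rw [mem_ball_zero_iff]
    calc ‖s‖ = ‖(s - beta6 D) + beta6 D‖ := by ring_nf
      _ ≤ ‖s - beta6 D‖ + ‖beta6 D‖ := norm_add_le _ _
      _ < 6 * a := by rw [hn6]; linarith
  have hz0 : (0 : ℂ) ∈ ball (0 : ℂ) a := mem_ball_self hα0
  have h6out : beta6 D ∉ closedBall (0 : ℂ) a := by
    rw [mem_closedBall_zero_iff, hn6]; linarith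
  have h0out : (0 : ℂ) ∉ closedBall (beta6 D) a := by
    rw [mem_closedBall, dist_comm, dist_zero_right, hn6]; linarith
  have h66 : beta6 D ∈ ball (beta6 D) a := mem_ball_self hα0
  -- the circles avoid `0`, and `ζ₁ ≠ 0` on them
  have hsph : ∀ (c : ℂ) (R : ℝ), (∀ θ, ‖circleMap c R θ‖ ≤ 5 * a) →
      ∀ θ, riemannZeta₁ (1 + circleMap c R θ - b) ≠ 0 := by
    intro c R hR θ
    refine hzU _ ?_
    rw [mem_ball_zero_iff]; linarith [hR θ]
  have hnorm0 : ∀ R θ, ‖circleMap 0 R θ‖ = |R| := fun R θ => by simp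
  have hnorm6 : ∀ θ, ‖circleMap (beta6 D) a θ - beta6 D‖ = a := fun θ => by
    simp [abs_of_pos hα0]
  have e5 : (∮ s in C((0 : ℂ), 5 * a), zetaRatio c' D j s * kerB (Pμ D) (beta6 D) l₁ s) =
      ∮ s in C((0 : ℂ), 5 * a), G s / (s * (s - beta6 D) ^ 2) := by
    refine circleIntegral_intB_eq_G c' D j l₁ (Pμ D) (beta6 D) (by positivity) (fun θ h => ?_)
      (hsph 0 (5 * a) fun θ => by rw [hnorm0, abs_of_pos (by positivity)]) hL
    have := hnorm0 (5 * a) θ; rw [h, norm_zero, abs_of_pos (by positivity)] at this; linarith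
  have e1 : (∮ s in C((0 : ℂ), a), zetaRatio c' D j s * kerB (Pμ D) (beta6 D) l₁ s) =
      ∮ s in C((0 : ℂ), a), G s / (s * (s - beta6 D) ^ 2) := by
    refine circleIntegral_intB_eq_G c' D j l₁ (Pμ D) (beta6 D) hα0.ne' (fun θ h => ?_)
      (hsph 0 a fun θ => by rw [hnorm0, abs_of_pos hα0]; linarith) hL
    have := hnorm0 a θ; rw [h, norm_zero, abs_of_pos hα0] at this; linarith
  have e6 : (∮ s in C(beta6 D, a), zetaRatio c' D j s * kerB (Pμ D) (beta6 D) l₁ s) =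
      ∮ s in C(beta6 D, a), G s / (s * (s - beta6 D) ^ 2) := by
    refine circleIntegral_intB_eq_G c' D j l₁ (Pμ D) (beta6 D) hα0.ne' (fun θ h => ?_)
      (hsph (beta6 D) a fun θ => ?_) hL
    · have := hnorm6 θ; rw [h, zero_sub, norm_neg, hn6] at this; linarith
    · calc ‖circleMap (beta6 D) a θ‖ = ‖(circleMap (beta6 D) a θ - beta6 D) + beta6 D‖ := by ring_nf
        _ ≤ ‖circleMap (beta6 D) a θ - beta6 D‖ + ‖beta6 D‖ := norm_add_le _ _
        _ ≤ 5 * a := by rw [hnorm6, hn6]; linarith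
  refine ⟨?_, ?_, ?_⟩
  · rw [e5]; exact cauchy_three_term hU hGd hcl5 hbig0 hbig6 h6ne
  · rw [e1]; exact cauchy_pole_zero_only hU hGd hcl1 hz0 h6out h6ne
  · rw [e6]; exact cauchy_pole_beta_only hU hGd hcl6 h0out h66

/-- **The two-circle split, `μ = 1`** ("the sum of the residues of the integrand at `s = 0` and
`s = β₆`"): for `D` large, `∮_{|s|=5α} intB1 = ∮_{|s|=α} intB1 + ∮_{|s−β₆|=α} intB1`.
[cite: Zhang2022LandauSiegel, App. B p.107] -/
theorem intB1_circle_split : ForAllLarge fun D _ _ => ∀ j ∈ ({1, 2, 3} : Finset ℕ), ∀ l₁ : ℕ,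
    1 ≤ l₁ → (∮ s in C((0 : ℂ), 5 * alpha D), zetaRatio c' D j s * kerB (P1 D) (beta6 D) l₁ s) =
      (∮ s in C((0 : ℂ), alpha D), zetaRatio c' D j s * kerB (P1 D) (beta6 D) l₁ s) +
        ∮ s in C(beta6 D, alpha D), zetaRatio c' D j s * kerB (P1 D) (beta6 D) l₁ s := by
  obtain ⟨D₀, h⟩ := circleIntegrals_intB_beta6 c' P1 one_lt_P1_mu1
  refine ⟨D₀, fun D _ χ hD _ _ j hj l₁ hl₁ => ?_⟩
  obtain ⟨h5, h1, h6⟩ := h D hD j hj l₁ hl₁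
  have h2pi : (2 * π * I : ℂ)⁻¹ ≠ 0 := inv_ne_zero (by simp [Real.pi_ne_zero, I_ne_zero])
  apply mul_left_cancel₀ h2pi
  rw [mul_add, h5, h1, h6]
  ring

/-- **The residue at `s = 0` in its true form, `μ = 1`**: for `D` large,
`(2πi)⁻¹∮_{|s|=α} intB1 = resZero1 · ζ₁(1−β_j)⁻¹` (`resZero1 = −β_j/(β₆² log P₁)`; the factor
`ζ₁(1−β_j)⁻¹ = (−β_j ζ(1−β_j))⁻¹ = 1 + O(α)`). [cite: Zhang2022LandauSiegel, App. B p.107] -/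
theorem circleIntegral_intB1_zero_eq : ForAllLarge fun D _ _ => ∀ j ∈ ({1, 2, 3} : Finset ℕ),
    ∀ l₁ : ℕ, 1 ≤ l₁ → (2 * π * I)⁻¹ * (∮ s in C((0 : ℂ), alpha D), zetaRatio c' D j s * kerB (P1 D) (beta6 D) l₁ s) =
      (-betaJ c' D j / (beta6 D ^ 2 * (Real.log (P1 D) : ℂ))) * (riemannZeta₁ (1 - betaJ c' D j))⁻¹ := by
  obtain ⟨D₀, h⟩ := circleIntegrals_intB_beta6 c' P1 one_lt_P1_mu1
  refine ⟨D₀, fun D _ χ hD _ _ j hj l₁ hl₁ => ?_⟩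
  obtain ⟨-, h1, -⟩ := h D hD j hj l₁ hl₁
  rw [h1]
  simp only [add_zero, zero_sub, riemannZeta₁_one, one_mul, cpow_zero, mul_one]
  ring

/-- **The residue at `0` against its printed shape, `μ = 1`**: for `D` large, `j ∈ {1,2,3}`, `l₁ ≥ 1`,
`‖(2πi)⁻¹∮_{|s|=α} intB1 − resZero1‖ ≤ (512K/(9π))·α` (`K` from `zeta1_near_one`):
`|resZero1| = |β_j|/(|β₆|² log P₁) ≤ 64/(9π)` and `|ζ₁(1−β_j)⁻¹ − 1| ≤ 8Kα`.
[cite: Zhang2022LandauSiegel, App. B p.107] -/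
theorem circleIntegral_intB1_zero_sub_resZero1_le : ∃ C : ℝ, ForAllLarge fun D _ _ =>
    ∀ j ∈ ({1, 2, 3} : Finset ℕ), ∀ l₁ : ℕ, 1 ≤ l₁ →
      ‖(2 * π * I)⁻¹ * (∮ s in C((0 : ℂ), alpha D), zetaRatio c' D j s * kerB (P1 D) (beta6 D) l₁ s) - (-betaJ c' D j / (beta6 D ^ 2 * (Real.log (P1 D) : ℂ)))‖ ≤
        C * alpha D := by
  obtain ⟨δ, hδ, K, hK, hζ⟩ := zeta1_near_one
  obtain ⟨D₀, h0⟩ := circleIntegral_intB1_zero_eq c'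
  refine ⟨512 * K / (9 * π),
    max D₀ (max 8 ⌈Real.exp (max (max 2 (60 * |c'| * π)) (max (10 * π / δ) (8 * K * π)))⌉₊),
    fun D _ χ hD hq hp j hj l₁ hl₁ => ?_⟩
  have hD₀ : D₀ ≤ D := le_trans (le_max_left _ _) hD
  obtain ⟨hℓ2, hc, hδα, hKα, hα0, -, -⟩ := large_package c' hδ hK
    (le_ell_of_ceil_exp_le₁ (le_trans (le_max_right _ _) (le_trans (le_max_right _ _) hD)))
  obtain ⟨-, hb4, -, -, -⟩ := betaJ_size c' hℓ2 hc hj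
  obtain ⟨-, hn6⟩ := beta6_size c' hℓ2 hc hj
  have hℓ0 : 0 < ell D := by linarith
  rw [h0 D χ hD₀ hq hp j hj l₁ hl₁]
  set b := betaJ c' D j with hb
  set w := riemannZeta₁ (1 - b) with hw
  have hw1 : ‖w - 1‖ ≤ 4 * K * alpha D := by
    have := (hζ (-b) (by rw [norm_neg]; linarith)).1
    rw [show (1 : ℂ) + -b = 1 - b by ring, norm_neg] at this
    calc ‖w - 1‖ ≤ K * ‖b‖ := this
      _ ≤ K * (4 * alpha D) := by gcongr
      _ = 4 * K * alpha D := by ring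
  have hwlow : 1 / 2 ≤ ‖w‖ := by
    have h := norm_sub_norm_le (1 : ℂ) w
    rw [norm_one, norm_sub_rev] at h
    linarith
  have hw0 : w ≠ 0 := by
    intro h; rw [h, norm_zero] at hwlow; linarith
  have hinv : ‖w⁻¹ - 1‖ ≤ 8 * K * alpha D := by
    have : w⁻¹ - 1 = w⁻¹ * (1 - w) := by field_simp
    rw [this, norm_mul, norm_inv, norm_sub_rev]
    calc ‖w‖⁻¹ * ‖w - 1‖ ≤ (1 / 2)⁻¹ * (4 * K * alpha D) :=
          mul_le_mul (inv_anti₀ (by norm_num) hwlow) hw1 (norm_nonneg _) (by norm_num)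
      _ = 8 * K * alpha D := by ring
  -- `|resZero1| ≤ 64/(9π)`: `|β_j| ≤ 4α`, `|β₆|² = 9α²/4`, `log P₁ = 0.504𝓛⁹ ≥ 𝓛⁹/4`, `α𝓛⁹ = π`
  have hLlow : ell D ^ 9 / 4 ≤ Real.log (P1 D) := by rw [log_P1_mu1]; nlinarith [pow_pos hℓ0 9]
  have hL0 : 0 < Real.log (P1 D) := lt_of_lt_of_le (by positivity) hLlow
  have hres : ‖(-betaJ c' D j / (beta6 D ^ 2 * (Real.log (P1 D) : ℂ)))‖ ≤ 64 / (9 * π) := by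
    have h9 : alpha D * ell D ^ 9 = π := by
      rw [alpha, bigP, Real.log_exp, div_mul_cancel₀ _ (pow_ne_zero _ hℓ0.ne')]
    rw [norm_div, norm_neg, norm_mul, norm_pow, Complex.norm_real, Real.norm_eq_abs,
      abs_of_pos hL0, hn6]
    rw [div_le_div_iff₀ (by positivity) (by positivity)]
    calc ‖b‖ * (9 * π) ≤ 4 * alpha D * (9 * (alpha D * ell D ^ 9)) := by rw [h9]; gcongr
      _ = 64 * ((3 / 2 * alpha D) ^ 2 * (ell D ^ 9 / 4)) := by ring
      _ ≤ 64 * ((3 / 2 * alpha D) ^ 2 * Real.log (P1 D)) := by gcongr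
  calc ‖(-betaJ c' D j / (beta6 D ^ 2 * (Real.log (P1 D) : ℂ))) * w⁻¹ - (-betaJ c' D j / (beta6 D ^ 2 * (Real.log (P1 D) : ℂ)))‖ = ‖(-betaJ c' D j / (beta6 D ^ 2 * (Real.log (P1 D) : ℂ)))‖ * ‖w⁻¹ - 1‖ := by
        rw [← norm_mul]; ring_nf
    _ ≤ 64 / (9 * π) * (8 * K * alpha D) := by gcongr
    _ = 512 * K / (9 * π) * alpha D := by ring

/-- **"`−β_j/(β₆² log P₁) = −j/(1.134πi) + O(α₁)`"** — the `μ = 1` twin of the residue-at-`0` value of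
App. B p. 107 (`1.134 = (3/2)²·0.504`): for `j ∈ {1,2,3}` and `D` large,
`‖resZero1 c′ D j − (−j/(1.134πi))‖ ≤ (20|c′|/(3·0.504π))·α𝓛 ≤ C·α₁`. With `β_j = jiα(1 + κ_jc′α𝓛)`,
`β₆ = 3iα/2`, `log P₁ = 0.504𝓛⁹` and `α𝓛⁹ = π` one has EXACTLY
`resZero1 = (4ji/9)(1 + κ_jc′α𝓛)/(0.504π)`, `−j/(1.134πi) = (4ji/9)/(0.504π)`; no `T`-term enters.
[cite: Zhang2022LandauSiegel, App. B p.107] -/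
theorem resZero1_sub_main_le :
    ∃ C : ℝ, ForAllLarge fun D _ _ => ∀ j ∈ ({1, 2, 3} : Finset ℕ),
      ‖(-betaJ c' D j / (beta6 D ^ 2 * (Real.log (P1 D) : ℂ))) - (-((j : ℂ) / (1.134 * π * I)))‖ ≤ C * alpha1 D := by
  refine ⟨20 * |c'| / (3 * (0.504 * π)), 8, fun D _ χ hD hq hp j hj => ?_⟩
  have hD8 : (8 : ℝ) ≤ D := by exact_mod_cast hD
  have hℓ2 : 2 ≤ ell D := by
    have he2 : Real.exp 2 ≤ 8 := by
      have h : Real.exp 2 = Real.exp 1 * Real.exp 1 := by rw [← Real.exp_add]; norm_num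
      rw [h]; nlinarith [Real.exp_one_lt_d9, Real.exp_pos 1]
    calc (2 : ℝ) = Real.log (Real.exp 2) := (Real.log_exp 2).symm
      _ ≤ Real.log 8 := Real.log_le_log (Real.exp_pos _) he2
      _ ≤ Real.log D := Real.log_le_log (by norm_num) hD8
  have hℓ1 : 1 ≤ ell D := by linarith
  have hℓ0 : 0 < ell D := by linarith
  set ℓ : ℝ := ell D with hℓ
  set a : ℝ := alpha D with ha
  have h9 : a * ℓ ^ 9 = π := by
    rw [ha, alpha, bigP, Real.log_exp, ← hℓ, div_mul_cancel₀ _ (pow_ne_zero _ hℓ0.ne')]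
  have ha0 : 0 < a := by
    rw [ha, alpha, bigP, Real.log_exp]; exact div_pos Real.pi_pos (pow_pos hℓ0 _)
  have haℓ : a * ℓ = π / ℓ ^ 8 := by
    rw [eq_div_iff (pow_ne_zero _ hℓ0.ne'), ← h9]; ring
  -- `log P₁ = 0.504 ℓ⁹`, so `a · log P₁ = 0.504 π`
  set L : ℝ := Real.log (P1 D) with hL
  have hLeq : L = 0.504 * ℓ ^ 9 := by rw [hL, log_P1_mu1]
  have haL : a * L = 0.504 * π := by rw [hLeq, ← h9]; ring
  have hL0 : 0 < L := by rw [hLeq]; positivity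
  -- `β_j`, `β₆`
  obtain ⟨κ, hκ, hβ⟩ := betaJ_eq_of_mem c' D hj
  set e : ℝ := κ * c' * a * ℓ with he
  have hβ6 : beta6 D = (((3 * a / 2 : ℝ)) : ℂ) * I := by rw [beta6, ← ha]; push_cast; ring
  -- the exact algebra
  have hI2 : (I : ℂ) ^ 2 = -1 := Complex.I_sq
  have ha' : (a : ℂ) ≠ 0 := by exact_mod_cast ha0.ne'
  have hL' : (L : ℂ) ≠ 0 := by exact_mod_cast hL0.ne'
  have hπ' : (π : ℂ) ≠ 0 := by exact_mod_cast Real.pi_ne_zero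
  have h11205 : (1.134 : ℂ) = (9 / 4 : ℂ) * 0.504 := by norm_num
  have key : (-betaJ c' D j / (beta6 D ^ 2 * (Real.log (P1 D) : ℂ))) - (-((j : ℂ) / (1.134 * π * I))) =
      (((4 * j / 9) * ((1 + e) / (a * L) - 1 / (0.504 * π)) : ℝ) : ℂ) * I := by
    rw [hβ, hβ6, ← hL, ← ha, h11205]
    push_cast
    field_simp
    rw [hI2]
    ring
  rw [key, norm_mul, Complex.norm_I, mul_one, Complex.norm_real, Real.norm_eq_abs]
  -- the real estimate: `(1+e)/(aL) − 1/(0.504π) = e/(0.504π)`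
  have hj3 : (j : ℝ) ≤ 3 := by
    simp only [Finset.mem_insert, Finset.mem_singleton] at hj
    rcases hj with rfl | rfl | rfl <;> norm_num
  have hj0 : (0 : ℝ) ≤ j := Nat.cast_nonneg j
  have hfrac : (1 + e) / (a * L) - 1 / (0.504 * π) = e / (0.504 * π) := by
    rw [haL]; field_simp; ring
  have habs_e : |e| ≤ 5 * |c'| * (π / ℓ ^ 8) := by
    rw [he, show κ * c' * a * ℓ = (κ * c') * (a * ℓ) by ring, abs_mul, abs_mul, haℓ,
      abs_of_pos (show (0 : ℝ) < π / ℓ ^ 8 by positivity)]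
    gcongr
  have hα1 : alpha1 D = π * ℓ ^ (1.1 : ℝ) / ℓ ^ 9 := by
    rw [alpha1, log_bigT, ← hℓ, ← ha, eq_div_iff (pow_ne_zero _ hℓ0.ne'), ← h9]; ring
  have h1l : ℓ ≤ ℓ ^ (1.1 : ℝ) := by
    calc ℓ = ℓ ^ (1 : ℝ) := (Real.rpow_one ℓ).symm
      _ ≤ ℓ ^ (1.1 : ℝ) := Real.rpow_le_rpow_of_exponent_le hℓ1 (by norm_num)
  -- `π/ℓ⁸ = a ℓ ≤ α₁`
  have haℓ_le : π / ℓ ^ 8 ≤ alpha1 D := by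
    rw [hα1, div_le_div_iff₀ (by positivity) (by positivity)]
    calc π * ℓ ^ 9 = π * ℓ * ℓ ^ 8 := by ring
      _ ≤ π * ℓ ^ (1.1 : ℝ) * ℓ ^ 8 := by gcongr
  rw [hfrac, abs_mul, abs_of_nonneg (by positivity : (0:ℝ) ≤ 4 * j / 9), abs_div,
    abs_of_pos (by positivity : (0:ℝ) < 0.504 * π)]
  calc 4 * (j : ℝ) / 9 * (|e| / (0.504 * π))
      ≤ 4 * 3 / 9 * ((5 * |c'| * (π / ℓ ^ 8)) / (0.504 * π)) := by gcongr
    _ ≤ 4 * 3 / 9 * ((5 * |c'| * alpha1 D) / (0.504 * π)) := by gcongr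
    _ = 20 * |c'| / (3 * (0.504 * π)) * alpha1 D := by ring

end Circles

/-! ## The `μ = 1` residue-sum assembly ("The same argument also gives …", the `μ = 1` case) -/

section MuOne

variable (c' : ℝ)

/-- **The `μ = 1` evaluation assembled from its steps — generic in the error rate `r`** (App. B p. 107,
tex L5311; target `Typed.AppendixB.StepB_u012` up to the rate): from the `μ = 1` Perron identity
(`Σ_l ϰ₁(l₁l)ϱ_j(l)/l = (1/2πi)∫_{(1)} intB1`, hypothesis `h9`), the `μ = 1` contour shift to the circle
`|s| = 5α` at rate `r` (`h9r`), the residue at `0` at rate `r` (`h10`, PROVED below for `r ≥ α₁`-type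
rates: `circleIntegral_intB1_zero_sub_resZero1_le` + `resZero1_sub_main_le`), and the VALUE of the
`β₆`-circle at rate `r` (`h11`: `(2πi)⁻¹∮_{|s−β₆|=α} intB1 = (1 − 2j/3 + j/(1.134πi))e^{0.756πi} + O(r)`),
to `Σ_l ϰ₁(l₁l)ϱ_j(l)/l = e′_{1j} + O(r)` (`e′_{1j}` = `Section18Defs.e1pj` = the sum of the two main
values, by `ring`); the two-circle split is the theorem `intB1_circle_split`.
[cite: Zhang2022LandauSiegel, App. B p.107] -/
theorem stepB_mu1_rate_of (r : ℕ → ℝ)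
    (h9 : ForAllLarge fun D _ _ => ∀ j ∈ ({1, 2, 3} : Finset ℕ), ∀ l₁ : ℕ, 1 ≤ l₁ →
      vkSum c' D (vk1 D) j l₁ = vline 1 (fun s => zetaRatio c' D j s * kerB (P1 D) (beta6 D) l₁ s))
    (h9r : ∃ C : ℝ, ForAllLarge fun D _ _ => ∀ j ∈ ({1, 2, 3} : Finset ℕ), ∀ l₁ : ℕ, 1 ≤ l₁ →
      l₁ ∈ nset (frakq D) → (l₁ : ℝ) < bigT D →
        ‖vline 1 (fun s => zetaRatio c' D j s * kerB (P1 D) (beta6 D) l₁ s) -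
            (2 * π * I)⁻¹ * (∮ s in C((0 : ℂ), 5 * alpha D), zetaRatio c' D j s * kerB (P1 D) (beta6 D) l₁ s)‖ ≤ C * r D)
    (h10 : ∃ C : ℝ, ForAllLarge fun D _ _ => ∀ j ∈ ({1, 2, 3} : Finset ℕ), ∀ l₁ : ℕ, 1 ≤ l₁ →
      ‖(2 * π * I)⁻¹ * (∮ s in C((0 : ℂ), alpha D), zetaRatio c' D j s * kerB (P1 D) (beta6 D) l₁ s) -
          (-((j : ℂ) / (1.134 * π * I)))‖ ≤ C * r D)
    (h11 : ∃ C : ℝ, ForAllLarge fun D _ _ => ∀ j ∈ ({1, 2, 3} : Finset ℕ), ∀ l₁ : ℕ, 1 ≤ l₁ →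
      l₁ ∈ nset (frakq D) → (l₁ : ℝ) < bigT D →
        ‖(2 * π * I)⁻¹ * (∮ s in C(beta6 D, alpha D), zetaRatio c' D j s * kerB (P1 D) (beta6 D) l₁ s) -
            (1 - 2 * (j : ℂ) / 3 + (j : ℂ) / (1.134 * π * I)) * cexp (0.756 * π * I)‖ ≤ C * r D) :
    ∃ C : ℝ, ForAllLarge fun D _ _ => ∀ j ∈ ({1, 2, 3} : Finset ℕ), ∀ l₁ : ℕ, 1 ≤ l₁ →
      l₁ ∈ nset (frakq D) → (l₁ : ℝ) < bigT D → ‖vkSum c' D (vk1 D) j l₁ - e1pj j‖ ≤ C * r D := by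
  obtain ⟨C₁, g1⟩ := h9r
  obtain ⟨C₂, g2⟩ := h10
  obtain ⟨C₃, g3⟩ := h11
  obtain ⟨D₀, h⟩ := (((h9.and g1).and (intB1_circle_split c')).and g2).and g3
  refine ⟨C₁ + C₂ + C₃, D₀, fun D _ χ hD hq hp j hj l₁ hl₁ hn hT => ?_⟩
  obtain ⟨⟨⟨⟨e9, e9r⟩, esp⟩, e10⟩, e11⟩ := h D χ hD hq hp
  have a9 := e9 j hj l₁ hl₁
  have a9r := e9r j hj l₁ hl₁ hn hT
  have asp := esp j hj l₁ hl₁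
  have a10 := e10 j hj l₁ hl₁
  have a11 := e11 j hj l₁ hl₁ hn hT
  set V := vline 1 (fun s => zetaRatio c' D j s * kerB (P1 D) (beta6 D) l₁ s)
  set I5 := ∮ s in C((0 : ℂ), 5 * alpha D), zetaRatio c' D j s * kerB (P1 D) (beta6 D) l₁ s
  set I0 := ∮ s in C((0 : ℂ), alpha D), zetaRatio c' D j s * kerB (P1 D) (beta6 D) l₁ s
  set Iβ := ∮ s in C(beta6 D, alpha D), zetaRatio c' D j s * kerB (P1 D) (beta6 D) l₁ s
  set m0 : ℂ := -((j : ℂ) / (1.134 * π * I))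
  set mβ : ℂ := (1 - 2 * (j : ℂ) / 3 + (j : ℂ) / (1.134 * π * I)) * cexp (0.756 * π * I)
  have he1pj : e1pj j = mβ + m0 := by simp only [e1pj, mβ, m0]; ring
  have key : vkSum c' D (vk1 D) j l₁ - e1pj j =
      (V - (2 * π * I)⁻¹ * I5) + ((2 * π * I)⁻¹ * I0 - m0) + ((2 * π * I)⁻¹ * Iβ - mβ) := by
    rw [a9, he1pj, asp, mul_add]; ring
  rw [key]
  calc _ ≤ ‖V - (2 * π * I)⁻¹ * I5‖ + ‖(2 * π * I)⁻¹ * I0 - m0‖ + ‖(2 * π * I)⁻¹ * Iβ - mβ‖ :=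
        norm_add₃_le
    _ ≤ C₁ * r D + C₂ * r D + C₃ * r D := add_le_add (add_le_add a9r a10) a11
    _ = (C₁ + C₂ + C₃) * r D := by ring

/-- **The residue at `0` of the `μ = 1` integrand at its main value, rate `α₁`** (discharges `h10` of
`stepB_mu1_rate_of` at `r = α₁`): for `D` large, `j ∈ {1,2,3}`, `l₁ ≥ 1`,
`‖(2πi)⁻¹∮_{|s|=α} intB1 − (−j/(1.134πi))‖ ≤ C·α₁` — from `circleIntegral_intB1_zero_sub_resZero1_le`
(rate `α ≤ α₁`) and `resZero1_sub_main_le`. [cite: Zhang2022LandauSiegel, App. B p.107] -/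
theorem circleIntegral_intB1_zero_sub_main_le : ∃ C : ℝ, ForAllLarge fun D _ _ =>
    ∀ j ∈ ({1, 2, 3} : Finset ℕ), ∀ l₁ : ℕ, 1 ≤ l₁ →
      ‖(2 * π * I)⁻¹ * (∮ s in C((0 : ℂ), alpha D), zetaRatio c' D j s * kerB (P1 D) (beta6 D) l₁ s) -
          (-((j : ℂ) / (1.134 * π * I)))‖ ≤ C * alpha1 D := by
  obtain ⟨C₁, h₁⟩ := circleIntegral_intB1_zero_sub_resZero1_le c'
  obtain ⟨C₂, h₂⟩ := resZero1_sub_main_le c'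
  obtain ⟨D₀, h⟩ := h₁.and h₂
  refine ⟨max C₁ 0 + C₂, max D₀ 3, fun D _ χ hD hq hp j hj l₁ hl₁ => ?_⟩
  obtain ⟨e₁, e₂⟩ := h D χ (le_trans (le_max_left _ _) hD) hq hp
  have a₁ := e₁ j hj l₁ hl₁
  have a₂ := e₂ j hj
  -- `α ≤ α₁` (`log T = 𝓛^{1.1} ≥ 1` for `D ≥ 3`)
  have hD3 : (3 : ℝ) ≤ D := by exact_mod_cast le_trans (le_max_right _ _) hD
  have hℓ1 : 1 ≤ ell D := by
    rw [ell, Real.le_log_iff_exp_le (by linarith)]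
    have := Real.exp_one_lt_d9; linarith
  have hα0 : 0 ≤ alpha D := by
    rw [alpha, bigP, Real.log_exp]; exact div_nonneg Real.pi_pos.le (pow_nonneg (by linarith) _)
  have hαα1 : alpha D ≤ alpha1 D := by
    rw [alpha1, log_bigT]
    have : (1 : ℝ) ≤ ell D ^ (1.1 : ℝ) := Real.one_le_rpow hℓ1 (by norm_num)
    nlinarith
  have hα1 : 0 ≤ alpha1 D := le_trans hα0 hαα1
  calc _ ≤ ‖(2 * π * I)⁻¹ * (∮ s in C((0 : ℂ), alpha D), zetaRatio c' D j s * kerB (P1 D) (beta6 D) l₁ s) - (-betaJ c' D j / (beta6 D ^ 2 * (Real.log (P1 D) : ℂ)))‖ +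
        ‖(-betaJ c' D j / (beta6 D ^ 2 * (Real.log (P1 D) : ℂ))) - (-((j : ℂ) / (1.134 * π * I)))‖ := norm_sub_le_norm_sub_add_norm_sub _ _ _
    _ ≤ C₁ * alpha D + C₂ * alpha1 D := add_le_add a₁ a₂
    _ ≤ max C₁ 0 * alpha1 D + C₂ * alpha1 D := by
        have hstep : C₁ * alpha D ≤ max C₁ 0 * alpha1 D :=
          calc C₁ * alpha D ≤ max C₁ 0 * alpha D := mul_le_mul_of_nonneg_right (le_max_left _ _) hα0
            _ ≤ max C₁ 0 * alpha1 D := mul_le_mul_of_nonneg_left hαα1 (le_max_right _ _)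
        linarith
    _ = (max C₁ 0 + C₂) * alpha1 D := by ring

/-- **`Typed.AppendixB.StepB_u012R c′` from its two remaining `μ = 1` inputs** ("The same argument also
gives `Σ_l ϰ₁(l₁l)ϱ_j(l)/l = … + O(α₁)`", App. B p. 107, tex L5311; the reading of record `α₁ = α log T`): GIVEN the `μ = 1` Perron identity `Σ_l ϰ₁(l₁l)ϱ_j(l)/l = (1/2πi)∫_{(1)} intB1` (the twin of
`StepB_u009`), the `μ = 1` line-to-circle bound `‖(1/2πi)∫_{(1)} intB1 − (2πi)⁻¹∮_{|s|=5α} intB1‖ ≤ C·α₁`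
(the twin of `StepB_u009rR`) and the value of the `β₆`-circle
`(2πi)⁻¹∮_{|s−β₆|=α} intB1 = (1 − 2j/3 + j/(1.134πi))e^{0.756πi} + O(α₁)` (the twin of `StepB_u011bR`),
the conclusion `Σ_l ϰ₁(l₁l)ϱ_j(l)/l = e′_{1j} + O(α₁)` follows — split and residue at `0` being THEOREMS of
this file. [cite: Zhang2022LandauSiegel, App. B p.107] -/
theorem stepB_u012R_of
    (h9 : ForAllLarge fun D _ _ => ∀ j ∈ ({1, 2, 3} : Finset ℕ), ∀ l₁ : ℕ, 1 ≤ l₁ →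
      vkSum c' D (vk1 D) j l₁ = vline 1 (fun s => zetaRatio c' D j s * kerB (P1 D) (beta6 D) l₁ s))
    (h9r : ∃ C : ℝ, ForAllLarge fun D _ _ => ∀ j ∈ ({1, 2, 3} : Finset ℕ), ∀ l₁ : ℕ, 1 ≤ l₁ →
      l₁ ∈ nset (frakq D) → (l₁ : ℝ) < bigT D →
        ‖vline 1 (fun s => zetaRatio c' D j s * kerB (P1 D) (beta6 D) l₁ s) -
            (2 * π * I)⁻¹ * (∮ s in C((0 : ℂ), 5 * alpha D), zetaRatio c' D j s * kerB (P1 D) (beta6 D) l₁ s)‖ ≤ C * alpha1 D)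
    (h11 : ∃ C : ℝ, ForAllLarge fun D _ _ => ∀ j ∈ ({1, 2, 3} : Finset ℕ), ∀ l₁ : ℕ, 1 ≤ l₁ →
      l₁ ∈ nset (frakq D) → (l₁ : ℝ) < bigT D →
        ‖(2 * π * I)⁻¹ * (∮ s in C(beta6 D, alpha D), zetaRatio c' D j s * kerB (P1 D) (beta6 D) l₁ s) -
            (1 - 2 * (j : ℂ) / 3 + (j : ℂ) / (1.134 * π * I)) * cexp (0.756 * π * I)‖ ≤
          C * alpha1 D) :
    Typed.AppendixB.StepB_u012R c' :=
  stepB_mu1_rate_of c' alpha1 h9 h9r (circleIntegral_intB1_zero_sub_main_le c') h11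

end MuOne

end Literature.NumberTheory.LFunctions.Zhang2022.Skeleton
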